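import Literature.AlgebraicGeometry.Frobenioids.GeometricFrobenioidThm62iFunctor
import Literature.AlgebraicGeometry.Frobenioids.MonoidFunctorsOnD

/-!
# Frobenioids I, §5: the functor of model Frobenioids induced by a morphism of model data over an EQUIVALENCE
# of bases with bijective components is an EQUIVALENCE (Cor. 5.4: "the horizontal arrows are equivalences")

Mochizuki, *The geometry of Frobenioids I: the general theory*, Kyushu J. Math. **62** (2008) 293–400,
§5, Theorem 5.2 (i) p. 100 (the model Frobenioid of data `(Φ, B, Div_B)`) and Corollary 5.4 p. 104 ("there
exists a 1-unique functor `Ψ^rlf : C₁^rlf → C₂^rlf` that fits into a 1-commutative diagram … [the horizontal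
arrows are equivalences of categories]"; proof: "follows immediately from Corollaries 4.10; 4.11, (iii), (iv)" —
the realified model Frobenioids are compared through the data `(Ψ^Base, Ψ^Φ)` of Cor. 4.11 (iii)/(iv), an
EQUIVALENCE of bases and an ISOMORPHISM of divisor monoids over it)
[cite: MochizukiFrdI2008, Thm. 5.2(i) p.100] [cite: MochizukiFrdI2008, Cor. 5.4 p.104].

The base-changing functoriality `ModelFrobenioid.DataHomOver G` / `DataHomOver.functor` of Thm. 5.2 (i)'s
construction is seat abc-iut-w5-d048's (`GeometricFrobenioidThm62iFunctor.lean`, for Thm. 6.2 (i)).  This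
file (cell abc-iut, L1 sub-DAG W3 row C54/L05, seat abc-iut-w5-d137) adds the EQUIVALENCE criterion:

* `DataHomOver.functor_faithful` (`G` faithful, `η`, `β` injective), `functor_full` (`G` full, `η` bijective,
  `β` surjective — the relation (d) of Thm. 5.2 (i) for a preimage candidate holds because `η^gp` is injective),
  `nonempty_iso_of_baseIso` (`(A, Φ₂(i)^gp(α')) ≅ (A', α')` along a base isomorphism `i : A ≅ A'`, by `(1, i, 0, 0)`),
  `functor_essSurj` (`G` essentially surjective, `η^gp` surjective);
* **`DataHomOver.functor_isEquivalence`**: over an equivalence of bases `G` and along bijective `η_X`, `β_X` the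
  induced functor of model Frobenioids is an equivalence of categories;
* (the functor lies over `G` ON THE NOSE: abc-iut-w5-d048's `functor_comp_baseFunctor`; `eqToIso` of it is the
  natural isomorphism when one is needed).

PROOF-ONLY (theorems, no `def`).  Consumer: `FrdI.Cor54Sub.RlfTransport` (the model-level `Ψ^rlf` of Cor. 5.4) and the transports of Thm. 6.4
(ii)–(iv).  No statement of the paper is re-typed; nothing here bears on [IUTchIII] Cor. 3.12.
-/

noncomputable section

namespace Literature.AlgebraicGeometry.Frobenioids

open CategoryTheory Opposite Function

universe w v₁ v₂ u₁ u₂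

namespace ModelFrobenioid

variable {D₁ : Type u₁} [Category.{v₁} D₁] {D₂ : Type u₂} [Category.{v₂} D₂]
  {Φ₁ B₁ : D₁ᵒᵖ ⥤ CommMonCat.{w}} {Φ₂ B₂ : D₂ᵒᵖ ⥤ CommMonCat.{w}}

/-- The pull-back maps of the restricted data `Φ₂|_{D₁} = G^op ⋙ Φ₂` on the groupifications ARE those of `Φ₂`
along `G f`. [cite: MochizukiFrdI2008, Thm. 5.2(i) p.100] -/
theorem pullGp_restrict (G : D₁ ⥤ D₂) {X Y : D₁} (f : X ⟶ Y)
    (c : Algebra.GrothendieckGroup (Φ₂.obj (op (G.obj Y)))) :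
    pullGp (G.op ⋙ Φ₂) f c = pullGp Φ₂ (G.map f) c := rfl

namespace DataHomOver

variable {G : D₁ ⥤ D₂} {DivB₁ : B₁ ⟶ monoidGp Φ₁} {DivB₂ : B₂ ⟶ monoidGp Φ₂}
  (h : DataHomOver G DivB₁ DivB₂)

/-! ### When `G` is an equivalence and `η`, `β` are bijective, the induced functor is an equivalence -/

/-- Faithfulness: `G` faithful and `η`, `β` injective. [cite: MochizukiFrdI2008, Cor. 5.4 p.104] -/
theorem functor_faithful [G.Faithful] (hη : ∀ X : D₁, Injective (h.η.app (op X)).hom)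
    (hβ : ∀ X : D₁, Injective (h.β.app (op X)).hom) : h.functor.Faithful := by
  refine ⟨fun {X Y} φ ψ e => ?_⟩
  have h1 : degFr (h.functor.map φ) = degFr (h.functor.map ψ) := congrArg _ e
  have h2 : baseMap (h.functor.map φ) = baseMap (h.functor.map ψ) := congrArg _ e
  have h3 : div (h.functor.map φ) = div (h.functor.map ψ) := congrArg _ e
  have h4 : unit (h.functor.map φ) = unit (h.functor.map ψ) := congrArg _ e
  apply hom_ext
  · exact h1
  · exact G.map_injective h2
  · exact hη _ h3
  · exact hβ _ h4

/-- Fullness: `G` full, `η` bijective, `β` surjective — the relation (d) of Thm. 5.2 (i) for the preimage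
candidate `(d, G⁻¹ f, η⁻¹ Div, β⁻¹ u)` holds because `η^gp` is injective.
[cite: MochizukiFrdI2008, Cor. 5.4 p.104] -/
theorem functor_full [G.Full] (hη : ∀ X : D₁, Bijective (h.η.app (op X)).hom)
    (hβ : ∀ X : D₁, Surjective (h.β.app (op X)).hom) : h.functor.Full := by
  refine ⟨fun {X Y} ψ => ?_⟩
  obtain ⟨z, hz⟩ := (hη X.base).2 (div ψ)
  obtain ⟨u, hu⟩ := hβ X.base (unit ψ)
  have hgp : Injective (gpApp h.η (op X.base)) := (gpMap_bijective_of_bijective _ (hη X.base)).1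
  refine ⟨{ degFr := degFr ψ, base := G.preimage (baseMap ψ), div := z, unit := u, rel := hgp ?_ }, ?_⟩
  · rw [map_mul, map_pow, MonGp.map_of, map_mul, gpApp_pullGp, h.comm, hz, hu, pullGp_restrict,
      G.map_preimage]
    exact rel ψ
  · apply hom_ext
    · rfl
    · exact G.map_preimage _
    · exact hz
    · exact hu

/-- For a base isomorphism `i : A ≅ A'` in `D₂`, the object `(A, Φ₂(i)^gp(α'))` of the model Frobenioid is
isomorphic to `(A', α')`, by `(1, i, 0, 0)` and `(1, i⁻¹, 0, 0)`. [cite: MochizukiFrdI2008, Thm. 5.2(i) p.100] -/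
theorem nonempty_iso_of_baseIso {A A' : D₂} (i : A ≅ A') (α' : Algebra.GrothendieckGroup (Φ₂.obj (op A'))) :
    Nonempty ((⟨A, pullGp Φ₂ i.hom α'⟩ : ModelFrobenioid Φ₂ B₂ DivB₂) ≅ ⟨A', α'⟩) := by
  refine ⟨{ hom := { degFr := 1, base := i.hom, div := 1, unit := 1, rel := ?_ }
            inv := { degFr := 1, base := i.inv, div := 1, unit := 1, rel := ?_ }
            hom_inv_id := ?_
            inv_hom_id := ?_ }⟩
  · rw [PNat.one_coe, pow_one, map_one, mul_one, map_one, mul_one]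
  · rw [PNat.one_coe, pow_one, map_one, mul_one, map_one, mul_one, ← pullGp_comp, Iso.inv_hom_id, pullGp_id]
  · apply hom_ext
    · rfl
    · exact i.hom_inv_id
    · change (Φ₂.map i.hom.op).hom 1 * 1 ^ ((1 : ℕ+) : ℕ) = 1
      rw [map_one, one_pow, mul_one]
    · change (B₂.map i.hom.op).hom 1 * 1 ^ ((1 : ℕ+) : ℕ) = 1
      rw [map_one, one_pow, mul_one]
  · apply hom_ext
    · rfl
    · exact i.inv_hom_id
    · change (Φ₂.map i.inv.op).hom 1 * 1 ^ ((1 : ℕ+) : ℕ) = 1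
      rw [map_one, one_pow, mul_one]
    · change (B₂.map i.inv.op).hom 1 * 1 ^ ((1 : ℕ+) : ℕ) = 1
      rw [map_one, one_pow, mul_one]

/-- Essential surjectivity: `G` essentially surjective and `η^gp` surjective.
[cite: MochizukiFrdI2008, Cor. 5.4 p.104] -/
theorem functor_essSurj [G.EssSurj] (hη : ∀ X : D₁, Bijective (h.η.app (op X)).hom) : h.functor.EssSurj := by
  refine ⟨fun Y => ?_⟩
  obtain ⟨A', α'⟩ := Y
  let A := G.objPreimage A'
  let i : G.obj A ≅ A' := G.objObjPreimageIso A'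
  obtain ⟨α, hα⟩ := (gpMap_bijective_of_bijective _ (hη A)).2 (pullGp Φ₂ i.hom α')
  refine ⟨⟨A, α⟩, ?_⟩
  rw [h.functor_obj]
  change Nonempty ((⟨G.obj A, gpApp h.η (op A) α⟩ : ModelFrobenioid Φ₂ B₂ DivB₂) ≅ ⟨A', α'⟩)
  rw [show gpApp h.η (op A) α = pullGp Φ₂ i.hom α' from hα]
  exact nonempty_iso_of_baseIso i α'

/-- **"The horizontal arrows are equivalences of categories"** (Cor. 5.4 p. 104): over an equivalence of bases
`G` and along bijective `η`, `β`, the induced functor of model Frobenioids is an equivalence.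
[cite: MochizukiFrdI2008, Cor. 5.4 p.104] -/
theorem functor_isEquivalence [G.IsEquivalence] (hη : ∀ X : D₁, Bijective (h.η.app (op X)).hom)
    (hβ : ∀ X : D₁, Bijective (h.β.app (op X)).hom) : h.functor.IsEquivalence := by
  haveI : h.functor.Faithful := h.functor_faithful (fun X => (hη X).1) (fun X => (hβ X).1)
  haveI : h.functor.Full := h.functor_full hη (fun X => (hβ X).2)
  haveI : h.functor.EssSurj := h.functor_essSurj hη
  exact {}

end DataHomOver

end ModelFrobenioid

end Literature.AlgebraicGeometry.Frobenioids

end
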